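import Mathlib
import Literature.MathematicalPhysics.QuantumLattice.GriffithsLemmaGroundStates
import Summits.HubbardSuperconductivity.HubbardSuperconductivity.Theses.LevyLogBootstrap

/-!
# Sketch — crux-ideate `DressHalfFilled` (stmt-HubbardSuperconductivity-8148), ideator k=2, round 1

First lemmas of the two idea cards (they must elaborate; proofs optional):

* CARD `rp-point-taylor-transfer` — `slope_pinned_by_positivity`: a nonnegative function with a
  two-sided quadratic Taylor control on `[-g₀, g₀]` keeps a definite fraction of its value at `0`
  on `[0, g]`; the (sign-indefinite) first-order response is pinned by positivity on the NEGATIVE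
  side of the coupling.  Used with `f g = Λ(g)` = `re ⟨ψ_g, Δ_d†Δ_d ψ_g⟩` along the dressing path
  `K₂ + g·R` (both signs of `g` are legitimate auxiliary Hamiltonians).
* CARD `smeared-kls-variational` — `order_floor_every_ground`: the variational ORDER FLOOR for EVERY
  sector ground state of a norm-small perturbation `H₀ + W` of a reference `H₀`, in terms of an
  energy secant of the REFERENCE pencil `H₀ + μ O` only; and the typed form of the card's bet #1
  (`XXZNoKink`: no kink of the half-filled XXZ sector energy in the smeared-planar-coupling
  direction, uniformly in the volume).
-/

namespace Summit.HubbardSuperconductivity.HubbardSuperconductivity.Cruxes.DressHalfFilled.IdeaSketch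

open Matrix
open Literature.Probability.LatticeModels Literature.MathematicalPhysics.QuantumLattice

/-! ## Card 1: positivity pins the slope -/

/-- **Positivity pins the slope.** If `f ≥ 0` on `[-g₀, g₀]`, `|f y - f 0 - d y| ≤ (B/2) y²` there,
and `c ≤ f 0`, then `f g ≥ c (1 - g/g₀) - (B/2)(g g₀ + g²)` for `g ∈ [0, g₀]` — whatever the sign
and size of the slope `d`. [folklore] -/
theorem slope_pinned_by_positivity (f : ℝ → ℝ) (d B c g₀ : ℝ) (hg₀ : 0 < g₀)
    (hpos : ∀ x ∈ Set.Icc (-g₀) g₀, 0 ≤ f x)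
    (hT : ∀ y ∈ Set.Icc (-g₀) g₀, |f y - f 0 - d * y| ≤ B / 2 * y ^ 2)
    (h0 : c ≤ f 0) :
    ∀ g ∈ Set.Icc (0:ℝ) g₀, c * (1 - g / g₀) - B / 2 * (g * g₀ + g ^ 2) ≤ f g := by
  intro g hg
  obtain ⟨hg0, hgg₀⟩ := hg
  have hf0 : 0 ≤ f 0 := hpos 0 ⟨by linarith, by linarith⟩
  have hTg := hT g ⟨by linarith, hgg₀⟩
  have hTp := hT g₀ ⟨by linarith, le_rfl⟩
  have hposp := hpos g₀ ⟨by linarith, le_rfl⟩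
  have h1 : f 0 + d * g - B / 2 * g ^ 2 ≤ f g := by
    have := (abs_le.mp hTg).1; linarith
  -- from `0 ≤ f g₀ ≤ f 0 + d g₀ + (B/2) g₀²`: the slope is bounded below
  have h2 : 0 ≤ f 0 + d * g₀ + B / 2 * g₀ ^ 2 := by
    have := (abs_le.mp hTp).2; linarith
  set q : ℝ := g / g₀ with hq_def
  have hq : 0 ≤ q := div_nonneg hg0 hg₀.le
  have hq1 : q ≤ 1 := (div_le_one hg₀).2 hgg₀
  have hqg : q * g₀ = g := div_mul_cancel₀ g hg₀.ne'
  -- multiply `h2` by `q ≥ 0` and use `q g₀ = g`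
  have h3 : -(q * f 0) - B / 2 * (g * g₀) ≤ d * g := by
    have hm := mul_nonneg hq h2
    have e1 : q * (f 0 + d * g₀ + B / 2 * g₀ ^ 2) =
        q * f 0 + d * (q * g₀) + B / 2 * ((q * g₀) * g₀) := by ring
    rw [e1, hqg] at hm
    linarith
  have h4 : c * (1 - q) ≤ f 0 * (1 - q) := mul_le_mul_of_nonneg_right h0 (by linarith)
  have e2 : c * (1 - q) = c - c * q := by ring
  have e3 : f 0 * (1 - q) = f 0 - q * f 0 := by ring
  rw [e2] at h4 ⊢
  rw [e3] at h4
  nlinarith [h1, h3, h4]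

/-! ## Card 2: the variational order floor for every ground state -/

/-- **Order floor for every sector ground state (variational).** Reference `H₀`, perturbation `W`
with Rayleigh quotients bounded by `w` on the unit sphere of the sector `K`, test observable `O`,
`μ > 0`.  Every sector ground state `ψ` of `H₀ + W` has
`re ⟨ψ, O ψ⟩ ≥ (minEnergyOn (H₀ + μ O) K - minEnergyOn H₀ K - 2w)/μ`: the supergradient
inequality for the pencil `(H₀ + W) + s O` at `s = 0` (`minEnergyOn_pencil_le_of_ground`) plus the
two variational comparisons `|minEnergyOn (A + W) K - minEnergyOn A K| ≤ w`.  Only ENERGIES of the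
REFERENCE pencil enter the floor. [folklore] -/
theorem re_rayleigh_add {n : Type*} [Fintype n] (A B : Matrix n n ℂ) (φ : n → ℂ) :
    (star φ ⬝ᵥ (A + B) *ᵥ φ).re = (star φ ⬝ᵥ A *ᵥ φ).re + (star φ ⬝ᵥ B *ᵥ φ).re := by
  rw [add_mulVec, dotProduct_add, Complex.add_re]

theorem re_rayleigh_real_smul {n : Type*} [Fintype n] (A : Matrix n n ℂ) (μ : ℝ) (φ : n → ℂ) :
    (star φ ⬝ᵥ ((μ : ℂ) • A) *ᵥ φ).re = μ * (star φ ⬝ᵥ A *ᵥ φ).re := by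
  rw [smul_mulVec, dotProduct_smul, smul_eq_mul, Complex.re_ofReal_mul]

/-- Variational comparison of sector energies under a Rayleigh-bounded perturbation:
`minEnergyOn A K - w ≤ minEnergyOn (A + W) K` and `minEnergyOn (A + W) K ≤ minEnergyOn A K + w`.
[folklore] -/
theorem minEnergyOn_add_ge_sub {n : Type*} [Fintype n] [DecidableEq n]
    {A W : Matrix n n ℂ} (hA : A.IsHermitian) (K : Submodule ℂ (n → ℂ)) {w : ℝ}
    (hWb : ∀ φ ∈ K, star φ ⬝ᵥ φ = 1 → |(star φ ⬝ᵥ W *ᵥ φ).re| ≤ w)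
    (hne : ∃ φ ∈ K, star φ ⬝ᵥ φ = 1) :
    A.minEnergyOn K - w ≤ (A + W).minEnergyOn K := by
  unfold Matrix.minEnergyOn
  obtain ⟨φ₀, hφ₀K, hφ₀1⟩ := hne
  refine le_csInf ⟨_, φ₀, hφ₀K, hφ₀1, rfl⟩ ?_
  rintro E ⟨φ, hφK, hφ1, rfl⟩
  have hle := minEnergyOn_le_rayleigh_of_mem hA K hφK hφ1
  have hw := (abs_le.mp (hWb φ hφK hφ1)).1
  unfold Matrix.minEnergyOn at hle
  rw [re_rayleigh_add]
  linarith

theorem minEnergyOn_add_le_add {n : Type*} [Fintype n] [DecidableEq n]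
    {A W : Matrix n n ℂ} (hAW : (A + W).IsHermitian) (K : Submodule ℂ (n → ℂ)) {w : ℝ}
    (hWb : ∀ φ ∈ K, star φ ⬝ᵥ φ = 1 → |(star φ ⬝ᵥ W *ᵥ φ).re| ≤ w)
    (hne : ∃ φ ∈ K, star φ ⬝ᵥ φ = 1) :
    (A + W).minEnergyOn K ≤ A.minEnergyOn K + w := by
  rw [← sub_le_iff_le_add]
  unfold Matrix.minEnergyOn
  obtain ⟨φ₀, hφ₀K, hφ₀1⟩ := hne
  refine le_csInf ⟨_, φ₀, hφ₀K, hφ₀1, rfl⟩ ?_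
  rintro E ⟨φ, hφK, hφ1, rfl⟩
  have hle := minEnergyOn_le_rayleigh_of_mem hAW K hφK hφ1
  have hw := (abs_le.mp (hWb φ hφK hφ1)).2
  unfold Matrix.minEnergyOn at hle
  rw [re_rayleigh_add] at hle
  linarith

/-- **Order floor for every sector ground state (variational).** Reference `H₀`, perturbation `W`
with Rayleigh quotients bounded by `w` on the unit sphere of the sector `K`, test observable `O`,
`μ > 0`.  Every sector ground state `ψ` of `H₀ + W` has
`re ⟨ψ, O ψ⟩ ≥ (minEnergyOn (H₀ + μ O) K - minEnergyOn H₀ K - 2w)/μ`: the supergradient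
inequality for the pencil `(H₀ + W) + s O` at `s = 0` (`minEnergyOn_pencil_le_of_ground`) plus the
two variational comparisons `|minEnergyOn (A + W) K - minEnergyOn A K| ≤ w`.  Only ENERGIES of the
REFERENCE pencil enter the floor. [folklore] -/
theorem order_floor_every_ground {n : Type*} [Fintype n] [DecidableEq n]
    {H₀ W O : Matrix n n ℂ} (hH₀ : H₀.IsHermitian) (hW : W.IsHermitian) (hO : O.IsHermitian)
    (K : Submodule ℂ (n → ℂ)) {μ w : ℝ} (hμ : 0 < μ)
    (hWb : ∀ φ ∈ K, star φ ⬝ᵥ φ = 1 → |(star φ ⬝ᵥ W *ᵥ φ).re| ≤ w)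
    {ψ : n → ℂ} (hψK : ψ ∈ K) (hψ1 : star ψ ⬝ᵥ ψ = 1)
    (hground : (star ψ ⬝ᵥ (H₀ + W) *ᵥ ψ).re = (H₀ + W).minEnergyOn K) :
    ((H₀ + (μ : ℂ) • O).minEnergyOn K - H₀.minEnergyOn K - 2 * w) / μ ≤
      (star ψ ⬝ᵥ O *ᵥ ψ).re := by
  have hne : ∃ φ ∈ K, star φ ⬝ᵥ φ = 1 := ⟨ψ, hψK, hψ1⟩
  have hHW : (H₀ + W).IsHermitian := hH₀.add hW
  -- supergradient inequality at `s = 0`, `t = μ` for the pencil `(H₀ + W) + s O`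
  have hg0 : (star ψ ⬝ᵥ (H₀ + W + ((0:ℝ) : ℂ) • O) *ᵥ ψ).re =
      (H₀ + W + ((0:ℝ) : ℂ) • O).minEnergyOn K := by
    simpa using hground
  have hsg := minEnergyOn_pencil_le_of_ground hHW hO K hψK hψ1 hg0 μ
  simp only [Complex.ofReal_zero, zero_smul, add_zero, sub_zero] at hsg
  -- the two variational comparisons
  have hμO : ((μ : ℂ) • O).IsHermitian := by
    rw [IsHermitian, conjTranspose_smul, hO.eq, Complex.star_def, Complex.conj_ofReal]
  have h1 : (H₀ + (μ : ℂ) • O).minEnergyOn K - w ≤ (H₀ + W + (μ : ℂ) • O).minEnergyOn K := by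
    have := minEnergyOn_add_ge_sub (hH₀.add hμO) K hWb hne
    have e : H₀ + (μ : ℂ) • O + W = H₀ + W + (μ : ℂ) • O := by abel
    rw [e] at this
    exact this
  have h2 : (H₀ + W).minEnergyOn K ≤ H₀.minEnergyOn K + w := minEnergyOn_add_le_add hHW K hWb hne
  rw [div_le_iff₀ hμ]
  nlinarith [hsg, h1, h2]

/-! ## Card 2, bet #1 typed on the XXZ side -/

/-- The **smeared planar pair operator** `O_φ = Σ_x Σ_r φ(r) S⁺_x S⁻_{x+r}` on the `M`-torus
(hard-core boson language: smeared one-body density matrix; `φ = δ_{e₁}+…` gives the n.n. XY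
energy, `φ ≡ M⁻²` the k=0 condensate `M⁻² S⁺_tot S⁻_tot`). [folklore] -/
noncomputable def smearedPlanarOp (M : ℕ) [NeZero M] (φ : TorusSite 2 M → ℝ) :
    Op (TorusSite 2 M) 2 :=
  ∑ x : TorusSite 2 M, ∑ r : TorusSite 2 M,
    ((φ r : ℝ) : ℂ) • (onSite x (spinRaise 1) * onSite (x + r) (spinLower 1))

/-- **Bet #1 of card `smeared-kls-variational` (NO KINK at the reflection-positive point).**
For an anisotropy `Δ` and a volume-indexed family of smearing profiles `φ M` (intended: one fixed
finitely supported, inversion-symmetric profile on `ℤ²` wrapped onto each torus): for every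
`ε > 0` there is `μ₀ > 0` such that for all `μ ∈ (0, μ₀)`, eventually in even `M`, the half-filled
sector energy of `H_M(Δ) + μ O_φ` exceeds that of `H_M(Δ)` by at least `μ (⟨ψ₀, O_φ ψ₀⟩ - ε M²)`
for EVERY normalised half-filled sector ground state `ψ₀` of `H_M(Δ)`.  (The reverse inequality
with `ε = 0` is the free supergradient inequality; this is left-equals-right derivative of the
limiting energy density in the `O_φ` direction, i.e. all translation-invariant infinite-volume
ground states of XXZ(`Δ`) share the value of the neutral finite-range observable `o_φ`.)
[cite: KomaTasaki1994] -/
def XXZNoKink (Δ : ℝ) (φ : ∀ M : ℕ, TorusSite 2 M → ℝ) : Prop :=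
  ∀ ε : ℝ, 0 < ε → ∃ μ₀ : ℝ, 0 < μ₀ ∧ ∀ μ ∈ Set.Ioo (0:ℝ) μ₀, ∃ M₀ : ℕ, ∀ (M : ℕ) [NeZero M],
    Even M → M₀ ≤ M →
    ∀ ψ₀ : TensorIndex (TorusSite 2 M) 2 → ℂ,
      ψ₀ ∈ spinZSector (Λ := TorusSite 2 M) 1 0 → star ψ₀ ⬝ᵥ ψ₀ = 1 →
      Matrix.mulVec (xxzHamiltonian 1 (torusGraph 2 M) (-1) Δ) ψ₀ =
        ((lowestEnergyInSector 1 (xxzHamiltonian 1 (torusGraph 2 M) (-1) Δ) 0 : ℝ) : ℂ) • ψ₀ →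
      μ * ((star ψ₀ ⬝ᵥ (smearedPlanarOp M (φ M)) *ᵥ ψ₀).re - ε * (M : ℝ) ^ 2) ≤
        lowestEnergyInSector 1
            (xxzHamiltonian 1 (torusGraph 2 M) (-1) Δ + ((μ : ℝ) : ℂ) • smearedPlanarOp M (φ M)) 0 -
          lowestEnergyInSector 1 (xxzHamiltonian 1 (torusGraph 2 M) (-1) Δ) 0

end Summit.HubbardSuperconductivity.HubbardSuperconductivity.Cruxes.DressHalfFilled.IdeaSketch
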